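import Literature.MathematicalPhysics.QuantumFieldTheory.Balaban1983to89.B9FromB6ModelSignsOn

/-!
# `Balaban1983to89.B9SectBStepWhole` — [B9] Sect. B (pp. 400–407) as the printed leaf `B9.SectBStepPrinted`: its
# kernel-checked REDUCTION to the printed block-steps («(3.42)–(3.47) for G′(U′U) … (3.48) … for G(U′U) …, of course with
# different constants»), so that each block can be inhabited separately at a pin

T. Bałaban, *Propagators for lattice gauge theories in a background field*, Commun. Math. Phys. **99** (1985) 389–434
[`Balaban1985BackgroundPropagators`, "B9"]; [4] = T. Bałaban, *Propagators and renormalization transformations for lattice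
gauge theories. II*, Commun. Math. Phys. **96** (1984) 223–250 [`Balaban1984PropagatorsII`].

statement-level skeleton of published theorems with citation tags; proofs where landed; nothing here is a claim about the
Yang–Mills mass gap

THE PRINTED LOCI (verbatim).  Theorem 3.4, p. 400: *"There exists a positive constant a₁ such that the operators G′(U),
(Q′(U)G′²(U)Q′*(U))⁻¹, R(U), G(U) extend to configurations U′U for α₁ ≦ a₁ as analytic functions of A. The extended
operators satisfy all the inequalities of Theorems 3.1–3.3 correspondingly."*; p. 402 (after (3.64)): *"applying
Theorem 3.1 for G′(U), the inequalities (3.63), (3.64), and Lemma 2.1 of [4] we can prove all the statements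
(3.42)–(3.47) for the operator G′(U′U), of course with different constants"*; (3.65)–(3.67) p. 403: *"The inverse
satisfies Theorem 3.2"*; p. 407 (after (3.86)): *"Thus Theorem 3.4 is proved, assuming that Theorems 3.1–3.3 hold."*

THE POINT.  The cell's typed skeleton carries Sect. B as ONE by-reference leaf `B9.SectBStepPrinted d c35 geo bg Gp GA
Cinv IsAnalyticExt` (`…Balaban1983to89.B9` :477): for ALL input constants of Theorems 3.1–3.3 at U there are an
M-threshold, an α₁-threshold a₁, an α₀-threshold and output constants (B₀′, δ₀′, B₀′(·), B′₀′(·), B′₀′(·,·), B₁′, δ₁′),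
SHARED by every block of `B9.Thms31to33IneqAt` at U′U: (3.42) + (3.46) + (3.47) and the Hölder block (3.43)–(3.45) for
BOTH G′ and G, and the kernel bound (3.48); plus the analytic extension.  The knit `B9LeafKnit` ∕ the DAG binding
consume it as the hypothesis `hB` (obligation 13 of `BalabanUVNodesN06AtRecord11CB10YZW`).  The tree's Sect. B
programme (cell `lit-balaban`, seat r06: `B9Thm34AllFinal.thm34_all_final` — the (3.42) entries of G′(U′U), G(U′U) and
(3.48); `B9Thm34HolderAllFinal.thm34_all_holder_final` — the four members of (3.43); `B9Ineq346L2Final` — (3.46)₁,₂,₃,₅;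
`B9Ineq347AllEntries` — (3.47) from (3.42)) proves the blocks SEPARATELY, each with its own constants, and does NOT
prove (3.44), (3.45), (3.46)₄,₆ at U′U (its own HONEST SCOPE lines; cell GAPS G-B9-02, B9-CLOSURE §5 item 3 (N)∕(O′)).
So `hB` is not inhabitable as a whole today, and what a pin CAN supply is block-shaped.  THIS FILE is the kernel-checked
reduction of the whole leaf to the printed block-steps:

* §1 the weakening lemmas («of course with different constants»): each of the six entry blocks of `B9FromB6`
  (`EBlock`, `L2Block`, `GlobBlock`, `H1Block`, `E4Block`, `H2Block`) and the kernel bound (3.48) is monotone in its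
  constants (larger constant, smaller rate) under the sign facts of the genuine lattice norms (3.39)–(3.41)
  (`B9FromB6ModelSignsOn.ModelSignsOn g P` for ANY sub-family `P` — the Hölder monotonicity field is never used, so the
  record's `modelSignsOn_geo9K` instantiates it; dag-n06-d INTERFACE-1); hence so are `B9.Ineq342_346_347` and `B9.Ineq343_345`;
* §2 `Step C pos Out` — the printed quantifier prefix of Sect. B («∀ input constants ∃ M₀, a₁, a₀′ and output constants
  c : C with `pos c`, ∀ i with M ≧ M₀, ∀ α₀ > 0 with Mα₀ ≦ a₀′, ∀ U (3.35)-regular at which Theorems 3.1–3.3 hold with the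
  input constants, ∀ 0 < α₁ ≦ a₁: `Out c i U α₁`»), with the two combinators `Step.and` (two steps ⇒ one step: max of
  the M-thresholds, min of the a's) and `Step.mono`; the TEN printed block-steps `StepE K`, `StepL2 K`, `StepGlob K`,
  `StepH1 K`, `StepE4 K`, `StepH2 K` (K = G′ or G; output = the block at every U′U, U′ in the class (3.37) at α₁),
  `StepKer` ((3.48) at U′U), `StepAnalytic IsAnalyticExt`; and `StepAll K` (the whole `Ineq342_346_347 ∧ Ineq343_345` of
  K at U′U with one constant tuple `Consts`);
* §3 `stepAll_of_blocks` — the six block-steps of K ⇒ `StepAll K` (constants merged by §1); ★ `sectBStepPrinted_of_steps`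
  — `StepAnalytic`, `StepAll G′`, `StepKer`, `StepAll G` ⇒ **`B9.SectBStepPrinted d c35 geo bg Gp GA Cinv IsAnalyticExt`**
  (the printed quantifier order, constants merged between G′ and G); ★ `sectBStepPrinted_of_blockSteps` — the same from
  the fourteen block-steps at once.  Conversely `step_of_sectBStepPrinted`-type projections are immediate and not
  needed by the knit.

WHAT IT GIVES THE NODE.  Obligation `hB` = fourteen separately pinnable printed block-steps; ten of them are in the range
of the r06 lineage (pins over `thm34_all_final` ∕ `thm34_all_holder_final` ∕ `thm34_Gp_l2_final` ∕ `thm34_G_l2_final` ∕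
`B9Ineq347AllEntries` ∕ the Neumann analyticity `B9Eq386NeumannAnalytic`, `B9Eq3193Analytic` — to be filed block by block),
four (`StepE4`, `StepH2` for G′ and for G = (3.44)–(3.45) at U′U) and the members (3.46)₄,₆ inside `StepL2` carry the
cell's OPEN items — the exact residual of `hB`, now NAMED.  HONEST SCOPE: nothing of print asserted; every block-step
is a HYPOTHESIS SCHEMA of printed shape; the weakening uses only the sign facts of (3.39)–(3.41) (`ModelSignsOn g P`, a
hypothesis on the carrier; its Hölder-monotonicity field is NOT used); count-neutral; NOT a node discharge; nothing continuum, nothing about the mass gap.  Cell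
`pub-ymgap` (HUMAN RULING D-0062), Track A node N06 [B9], N06-ASSIGNMENT row 13, seat `pub-ymgap-dag-n06-c`, 2026-08-26.
-/

namespace Literature.MathematicalPhysics.QuantumFieldTheory.Balaban1983to89.B9SectBStepWhole

open Literature.MathematicalPhysics.QuantumFieldTheory.Balaban1983to89
open B9FromB6 B9FromB6ModelSignsOn

/-! ## §1 «Of course with different constants» — weakening of the blocks under the model signs -/

section Mono

variable {g : B9.Geometry} {B : B9.Backgrounds} {P : g.Loc → Prop}

/-- (3.42) with (B₀, δ₀) ⇒ (3.42) with any B₀′ ≧ max(B₀, 0), δ₀′ ≦ δ₀ (L^jη ≧ 0, |λ| ≧ 0, d ≧ 0).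
[cite: Balaban1985BackgroundPropagators, (3.42) p.397 + p.403] -/
theorem eBlock_mono (S : ModelSignsOn g P) {K : B9.KernelFamily g B} {B₀ B₀' δ₀ δ₀' : ℝ} {U : B.Cfg}
    (h : EBlock K B₀ δ₀ U) (hB : B₀ ≤ B₀') (hB' : 0 ≤ B₀') (hδ : δ₀' ≤ δ₀) : EBlock K B₀' δ₀' U :=
  fun n lam y y' hs =>
    weaken4 (h n lam y y' hs) hB hB' (pref4_nonneg (S.len_nonneg y) n) (S.supNorm_nonneg lam) hδ (S.dist_nonneg y y')

/-- (3.46) with (B₀, δ₀) ⇒ (3.46) with B₀′ ≧ max(B₀, 0), δ₀′ ≦ δ₀ (|h| ≧ 0, ‖λ‖ ≧ 0).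
[cite: Balaban1985BackgroundPropagators, (3.46) p.398 + p.403] -/
theorem l2Block_mono (S : ModelSignsOn g P) {K : B9.KernelFamily g B} {B₀ B₀' δ₀ δ₀' : ℝ} {U : B.Cfg}
    (h : L2Block K B₀ δ₀ U) (hB : B₀ ≤ B₀') (hB' : 0 ≤ B₀') (hδ : δ₀' ≤ δ₀) : L2Block K B₀' δ₀' U :=
  fun n lam hc y y' hcut hs =>
    weaken5 (h n lam hc y y' hcut hs) hB hB' (pref6_nonneg (S.len_nonneg y) n) (S.cutSup_nonneg hc)
      (S.l2Norm_nonneg lam) hδ (S.dist_nonneg y y')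

/-- (3.47) with B₀ ⇒ (3.47) with B₀′ ≧ B₀ (|λ|_{(γ)} ≧ 0). [cite: Balaban1985BackgroundPropagators, (3.47) p.398 + p.403] -/
theorem globBlock_mono (S : ModelSignsOn g P) {K : B9.KernelFamily g B} {B₀ B₀' : ℝ} {U : B.Cfg}
    (h : GlobBlock K B₀ U) (hB : B₀ ≤ B₀') : GlobBlock K B₀' U :=
  fun n lam γ h1 h2 => (h n lam γ h1 h2).trans (mul_le_mul_of_nonneg_right hB (S.wNorm_nonneg γ lam))

/-- (3.43) with (B₀(·), δ₀) ⇒ (3.43) with B₀′(β) ≧ max(B₀(β), 0), δ₀′ ≦ δ₀ ((L^jη)^{1−β} ≧ 0, ‖ζ‖ + |ζ| ≧ 0).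
[cite: Balaban1985BackgroundPropagators, (3.43) p.398 + p.403] -/
theorem h1Block_mono (S : ModelSignsOn g P) {K : B9.KernelFamily g B} {Bβ Bβ' : ℝ → ℝ} {δ₀ δ₀' : ℝ} {U : B.Cfg}
    (h : H1Block K Bβ δ₀ U) (hB : ∀ β, Bβ β ≤ Bβ' β) (hB' : ∀ β, 0 ≤ Bβ' β) (hδ : δ₀' ≤ δ₀) :
    H1Block K Bβ' δ₀' U :=
  fun β lam ζ y y' h0 h1 hζ hs =>
    weaken5 (h β lam ζ y y' h0 h1 hζ hs) (hB β) (hB' β) (Real.rpow_nonneg (S.len_nonneg y) _) (S.cutH_nonneg β ζ)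
      (S.supNorm_nonneg lam) hδ (S.dist_nonneg y y')

/-- (3.44) with (B′₀(·), δ₀) ⇒ (3.44) with B′₀′(ε) ≧ max(B′₀(ε), 0), δ₀′ ≦ δ₀ (‖λ‖_ε + |λ| ≧ 0).
[cite: Balaban1985BackgroundPropagators, (3.44) p.398 + p.403] -/
theorem e4Block_mono (S : ModelSignsOn g P) {K : B9.KernelFamily g B} {Bε Bε' : ℝ → ℝ} {δ₀ δ₀' : ℝ} {U : B.Cfg}
    (h : E4Block K Bε δ₀ U) (hB : ∀ ε, Bε ε ≤ Bε' ε) (hB' : ∀ ε, 0 ≤ Bε' ε) (hδ : δ₀' ≤ δ₀) :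
    E4Block K Bε' δ₀' U :=
  fun ε lam y y' h0 h1 hs =>
    weaken3 (h ε lam y y' h0 h1 hs) (hB ε) (hB' ε) (add_nonneg (S.holder_nonneg ε lam) (S.supNorm_nonneg lam)) hδ
      (S.dist_nonneg y y')

/-- (3.45) with (B′₀(·,·), δ₀) ⇒ (3.45) with B′₀′(ε, β) ≧ max(B′₀(ε, β), 0), δ₀′ ≦ δ₀ ((L^jη)^{−β} ≧ 0).
[cite: Balaban1985BackgroundPropagators, (3.45) p.398 + p.403] -/
theorem h2Block_mono (S : ModelSignsOn g P) {K : B9.KernelFamily g B} {Bεβ Bεβ' : ℝ → ℝ → ℝ} {δ₀ δ₀' : ℝ} {U : B.Cfg}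
    (h : H2Block K Bεβ δ₀ U) (hB : ∀ ε β, Bεβ ε β ≤ Bεβ' ε β) (hB' : ∀ ε β, 0 ≤ Bεβ' ε β) (hδ : δ₀' ≤ δ₀) :
    H2Block K Bεβ' δ₀' U :=
  fun ε β lam ζ y y' h0 h1 h2 h3 hζ hs =>
    weaken5 (h ε β lam ζ y y' h0 h1 h2 h3 hζ hs) (hB ε β) (hB' ε β) (Real.rpow_nonneg (S.len_nonneg y) _)
      (S.cutH_nonneg β ζ) (add_nonneg (S.holder_nonneg (β + ε) lam) (S.supNorm_nonneg lam)) hδ (S.dist_nonneg y y')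

/-- (3.48) with (B₁, δ₁) ⇒ (3.48) with B₁′ ≧ max(B₁, 0), δ₁′ ≦ δ₁ ((L^jη)^{−4}, (L^{j′}η)^{−d} ≧ 0).
[cite: Balaban1985BackgroundPropagators, (3.48) p.398 + (3.67) p.403] -/
theorem kerBound_mono (S : ModelSignsOn g P) (d : ℕ) {C : B9.SiteKernel g B} {B₁ B₁' δ₁ δ₁' : ℝ} {U : B.Cfg}
    (h : ∀ y y' : g.Site, |C.ker U y y'| ≤
      B₁ * (g.len y) ^ (-(4 : ℝ)) * (g.len y') ^ (-(d : ℝ)) * Real.exp (-(δ₁ * g.dist y y')))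
    (hB : B₁ ≤ B₁') (hB' : 0 ≤ B₁') (hδ : δ₁' ≤ δ₁) :
    ∀ y y' : g.Site, |C.ker U y y'| ≤
      B₁' * (g.len y) ^ (-(4 : ℝ)) * (g.len y') ^ (-(d : ℝ)) * Real.exp (-(δ₁' * g.dist y y')) := by
  intro y y'
  have h1 : |C.ker U y y'| ≤
      B₁ * (g.len y) ^ (-(4 : ℝ)) * (g.len y') ^ (-(d : ℝ)) * Real.exp (-(δ₁ * g.dist y y')) * 1 := by
    rw [mul_one]; exact h y y'
  have h2 := weaken5 h1 hB hB' (Real.rpow_nonneg (S.len_nonneg y) _) (Real.rpow_nonneg (S.len_nonneg y') _)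
    zero_le_one hδ (S.dist_nonneg y y')
  rw [mul_one] at h2
  exact h2

/-- «(3.42)–(3.47) … of course with different constants» for the block (3.42) + (3.46) + (3.47) of one kernel family.
[cite: Balaban1985BackgroundPropagators, Thm 3.1 pp.397–398 + p.403] -/
theorem ineq342_346_347_mono (S : ModelSignsOn g P) {K : B9.KernelFamily g B} {B₀ B₀' δ₀ δ₀' : ℝ} {U : B.Cfg}
    (h : B9.Ineq342_346_347 K B₀ δ₀ U) (hB : B₀ ≤ B₀') (hB' : 0 ≤ B₀') (hδ : δ₀' ≤ δ₀) :
    B9.Ineq342_346_347 K B₀' δ₀' U :=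
  ⟨eBlock_mono S h.1 hB hB' hδ, l2Block_mono S h.2.1 hB hB' hδ, globBlock_mono S h.2.2 hB⟩

/-- The same for the Hölder block (3.43)–(3.45). [cite: Balaban1985BackgroundPropagators, (3.43)–(3.45) p.398 + p.403] -/
theorem ineq343_345_mono (S : ModelSignsOn g P) {K : B9.KernelFamily g B} {Bβ Bβ' Bε Bε' : ℝ → ℝ}
    {Bεβ Bεβ' : ℝ → ℝ → ℝ} {δ₀ δ₀' : ℝ} {U : B.Cfg} (h : B9.Ineq343_345 K Bβ Bε Bεβ δ₀ U)
    (hβ : ∀ β, Bβ β ≤ Bβ' β) (hβ' : ∀ β, 0 ≤ Bβ' β) (hε : ∀ ε, Bε ε ≤ Bε' ε) (hε' : ∀ ε, 0 ≤ Bε' ε)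
    (hεβ : ∀ ε β, Bεβ ε β ≤ Bεβ' ε β) (hεβ' : ∀ ε β, 0 ≤ Bεβ' ε β) (hδ : δ₀' ≤ δ₀) :
    B9.Ineq343_345 K Bβ' Bε' Bεβ' δ₀' U :=
  ⟨h1Block_mono S h.1 hβ hβ' hδ, e4Block_mono S h.2.1 hε hε' hδ, h2Block_mono S h.2.2 hεβ hεβ' hδ⟩

end Mono

/-! ## §2 The printed quantifier prefix of Sect. B and the block-steps -/

section Steps

variable {I : Type} (d : ℕ) (c35 : ℝ) (geo : I → B9.Geometry) (bg : I → B9.Backgrounds)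
  (Gp GA : ∀ i, B9.KernelFamily (geo i) (bg i)) (Cinv : ∀ i, B9.SiteKernel (geo i) (bg i))

/-- **THE PRINTED QUANTIFIER PREFIX OF SECT. B** (`B9.SectBStepPrinted`, pp. 400–407: *"for α₁ sufficiently small"*,
*"an M-threshold M₀ is allowed, as everywhere in the paper"*, *"for Mα₀, α₁ sufficiently small"* at (3.69),
(3.78)–(3.81)) for ONE output statement: for all input constants of Theorems 3.1–3.3 there are thresholds M₀, a₁, a₀′
and output constants `c : C` with `pos c` such that for every member with M ≧ M₀, every 0 < α₀ with Mα₀ ≦ a₀′, every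
U satisfying (3.35) at which Theorems 3.1–3.3 hold with the input constants, and every 0 < α₁ ≦ a₁: `Out c i U α₁`.
[cite: Balaban1985BackgroundPropagators, Sect. B pp.400–407 + Thm 3.4 p.400] -/
def Step (C : Type) (pos : C → Prop) (Out : C → ∀ i, (bg i).Cfg → ℝ → Prop) : Prop :=
  ∀ (B₀ δ₀ : ℝ) (Bβ Bε : ℝ → ℝ) (Bεβ : ℝ → ℝ → ℝ) (B₁ δ₁ : ℝ),
    ∃ M₀ a₁ a₀' : ℝ, ∃ c : C, 0 < M₀ ∧ 0 < a₁ ∧ 0 < a₀' ∧ pos c ∧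
      ∀ i : I, M₀ ≤ (geo i).M → ∀ α₀ : ℝ, 0 < α₀ → (geo i).M * α₀ ≤ a₀' →
        ∀ U : (bg i).Cfg, (bg i).Reg335 c35 α₀ U →
          B9.Thms31to33IneqAt d (Gp i) (GA i) (Cinv i) B₀ δ₀ Bβ Bε Bεβ B₁ δ₁ U →
            ∀ α₁ : ℝ, 0 < α₁ → α₁ ≤ a₁ → Out c i U α₁

/-- **Block-step (3.42) for K(U′U)** (K = G′: p. 402 *"we can prove all the statements (3.42)–(3.47) for the operator
G′(U′U)"*; K = G: (3.84)–(3.86) p. 407): output constants (B₀′, δ₀′) > 0, conclusion `EBlock (K i) B₀′ δ₀′ (U′U)` for every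
U′ in the class (3.37) at α₁. [cite: Balaban1985BackgroundPropagators, (3.42) p.397 + (3.64) p.402 + (3.86) p.407] -/
def StepE (K : ∀ i, B9.KernelFamily (geo i) (bg i)) : Prop :=
  Step d c35 geo bg Gp GA Cinv (ℝ × ℝ) (fun c => 0 < c.1 ∧ 0 < c.2)
    (fun c i U α₁ => ∀ U' : (bg i).Cfg, (bg i).Cplx337 α₁ U U' → EBlock (K i) c.1 c.2 ((bg i).mul U' U))

/-- **Block-step (3.46) for K(U′U)** (the six L² members; (3.46)₄,₆ at U′U are NOT in the tree — GAPS G-B9-02 (O′)).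
[cite: Balaban1985BackgroundPropagators, (3.46) p.398 + p.402] -/
def StepL2 (K : ∀ i, B9.KernelFamily (geo i) (bg i)) : Prop :=
  Step d c35 geo bg Gp GA Cinv (ℝ × ℝ) (fun c => 0 < c.1 ∧ 0 < c.2)
    (fun c i U α₁ => ∀ U' : (bg i).Cfg, (bg i).Cplx337 α₁ U U' → L2Block (K i) c.1 c.2 ((bg i).mul U' U))

/-- **Block-step (3.47) for K(U′U)** (the four weighted members; in print a consequence of (3.42), `B9Ineq347AllEntries`).
[cite: Balaban1985BackgroundPropagators, (3.47) p.398 + p.402] -/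
def StepGlob (K : ∀ i, B9.KernelFamily (geo i) (bg i)) : Prop :=
  Step d c35 geo bg Gp GA Cinv ℝ (fun c => 0 < c)
    (fun c i U α₁ => ∀ U' : (bg i).Cfg, (bg i).Cplx337 α₁ U U' → GlobBlock (K i) c ((bg i).mul U' U))

/-- **Block-step (3.43) for K(U′U)** (output B₀′(·), δ₀′ > 0). [cite: Balaban1985BackgroundPropagators, (3.43) p.398 + p.402] -/
def StepH1 (K : ∀ i, B9.KernelFamily (geo i) (bg i)) : Prop :=
  Step d c35 geo bg Gp GA Cinv ((ℝ → ℝ) × ℝ) (fun c => 0 < c.2)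
    (fun c i U α₁ => ∀ U' : (bg i).Cfg, (bg i).Cplx337 α₁ U U' → H1Block (K i) c.1 c.2 ((bg i).mul U' U))

/-- **Block-step (3.44) for K(U′U)** (output B′₀′(·), δ₀′ > 0; at U′U NOT in the tree — GAPS G-B9-02 (N)).
[cite: Balaban1985BackgroundPropagators, (3.44) p.398 + p.402] -/
def StepE4 (K : ∀ i, B9.KernelFamily (geo i) (bg i)) : Prop :=
  Step d c35 geo bg Gp GA Cinv ((ℝ → ℝ) × ℝ) (fun c => 0 < c.2)
    (fun c i U α₁ => ∀ U' : (bg i).Cfg, (bg i).Cplx337 α₁ U U' → E4Block (K i) c.1 c.2 ((bg i).mul U' U))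

/-- **Block-step (3.45) for K(U′U)** (output B′₀′(·,·), δ₀′ > 0; at U′U NOT in the tree — GAPS G-B9-02 (N)).
[cite: Balaban1985BackgroundPropagators, (3.45) p.398 + p.402] -/
def StepH2 (K : ∀ i, B9.KernelFamily (geo i) (bg i)) : Prop :=
  Step d c35 geo bg Gp GA Cinv ((ℝ → ℝ → ℝ) × ℝ) (fun c => 0 < c.2)
    (fun c i U α₁ => ∀ U' : (bg i).Cfg, (bg i).Cplx337 α₁ U U' → H2Block (K i) c.1 c.2 ((bg i).mul U' U))

/-- **Block-step (3.48) for (Q′G′²Q′*)⁻¹(U′U)** ((3.65)–(3.67), p. 403: *"The inverse satisfies Theorem 3.2"*), output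
(B₁′, δ₁′) > 0; stated for an output site-kernel family `C` (= `Cinv` in the leaf), as `StepE` is for an output `K`.
[cite: Balaban1985BackgroundPropagators, (3.48) p.398 + (3.65)–(3.67) p.403] -/
def StepKer (C : ∀ i, B9.SiteKernel (geo i) (bg i)) : Prop :=
  Step d c35 geo bg Gp GA Cinv (ℝ × ℝ) (fun c => 0 < c.1 ∧ 0 < c.2)
    (fun c i U α₁ => ∀ U' : (bg i).Cfg, (bg i).Cplx337 α₁ U U' → ∀ y y' : (geo i).Site,
      |(C i).ker ((bg i).mul U' U) y y'| ≤
        c.1 * ((geo i).len y) ^ (-(4 : ℝ)) * ((geo i).len y') ^ (-(d : ℝ)) * Real.exp (-(c.2 * (geo i).dist y y')))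

/-- **The analytic-extension step** (Theorem 3.4: *"extend to configurations U′U for α₁ ≦ a₁ as analytic functions of
A"*; mechanism (3.62)–(3.63), (3.86)) for G′ and G, with the leaf's abstract predicate `IsAnalyticExt`; no output
constants (`PUnit`, positivity `True`). [cite: Balaban1985BackgroundPropagators, Thm 3.4 p.400 + (3.62)–(3.63) p.402 + (3.86) p.407] -/
def StepAnalytic (IsAnalyticExt : ∀ i, B9.KernelFamily (geo i) (bg i) → (bg i).Cfg → ℝ → Prop) : Prop :=
  Step d c35 geo bg Gp GA Cinv PUnit (fun _ => True)
    (fun _ i U α₁ => IsAnalyticExt i (Gp i) U α₁ ∧ IsAnalyticExt i (GA i) U α₁)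

/-- The constant tuple (B₀, δ₀, B₀(·), B′₀(·), B′₀(·,·)) of Theorems 3.1 ∕ 3.3 for one kernel family.
[cite: Balaban1985BackgroundPropagators, Thm 3.1 p.397] -/
structure Consts where
  B₀ : ℝ
  δ₀ : ℝ
  Bβ : ℝ → ℝ
  Bε : ℝ → ℝ
  Bεβ : ℝ → ℝ → ℝ

/-- **All of (3.42)–(3.47) for K(U′U) with ONE constant tuple** — the K-part of the conclusion of `B9.SectBStepPrinted`.
[cite: Balaban1985BackgroundPropagators, Thm 3.4 p.400 + (3.42)–(3.47) pp.397–398] -/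
def StepAll (K : ∀ i, B9.KernelFamily (geo i) (bg i)) : Prop :=
  Step d c35 geo bg Gp GA Cinv Consts (fun c => 0 < c.B₀ ∧ 0 < c.δ₀)
    (fun c i U α₁ => ∀ U' : (bg i).Cfg, (bg i).Cplx337 α₁ U U' →
      B9.Ineq342_346_347 (K i) c.B₀ c.δ₀ ((bg i).mul U' U) ∧
        B9.Ineq343_345 (K i) c.Bβ c.Bε c.Bεβ c.δ₀ ((bg i).mul U' U))

variable {d c35 geo bg Gp GA Cinv}

/-- **Two steps ⇒ one step** (M-threshold = max, α₁- and α₀-thresholds = min; conclusions conjoined): the arithmetic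
of *"for α₁ sufficiently small"* done once. [cite: Balaban1985BackgroundPropagators, Sect. B p.402 + p.407] -/
theorem Step.and {C₁ C₂ : Type} {p₁ : C₁ → Prop} {p₂ : C₂ → Prop} {O₁ : C₁ → ∀ i, (bg i).Cfg → ℝ → Prop}
    {O₂ : C₂ → ∀ i, (bg i).Cfg → ℝ → Prop} (h₁ : Step d c35 geo bg Gp GA Cinv C₁ p₁ O₁)
    (h₂ : Step d c35 geo bg Gp GA Cinv C₂ p₂ O₂) :
    Step d c35 geo bg Gp GA Cinv (C₁ × C₂) (fun c => p₁ c.1 ∧ p₂ c.2)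
      (fun c i U α₁ => O₁ c.1 i U α₁ ∧ O₂ c.2 i U α₁) := by
  intro B₀ δ₀ Bβ Bε Bεβ B₁ δ₁
  obtain ⟨M₁, a₁, b₁, c₁, hM₁, ha₁, hb₁, hp₁, H₁⟩ := h₁ B₀ δ₀ Bβ Bε Bεβ B₁ δ₁
  obtain ⟨M₂, a₂, b₂, c₂, _hM₂, ha₂, hb₂, hp₂, H₂⟩ := h₂ B₀ δ₀ Bβ Bε Bεβ B₁ δ₁
  refine ⟨max M₁ M₂, min a₁ a₂, min b₁ b₂, (c₁, c₂), lt_max_of_lt_left hM₁, lt_min ha₁ ha₂, lt_min hb₁ hb₂,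
    ⟨hp₁, hp₂⟩, ?_⟩
  intro i hM α₀ hα₀ hMa U hU hT α₁ hα₁ ha
  exact ⟨H₁ i (le_trans (le_max_left _ _) hM) α₀ hα₀ (le_trans hMa (min_le_left _ _)) U hU hT α₁ hα₁
      (le_trans ha (min_le_left _ _)),
    H₂ i (le_trans (le_max_right _ _) hM) α₀ hα₀ (le_trans hMa (min_le_right _ _)) U hU hT α₁ hα₁
      (le_trans ha (min_le_right _ _))⟩

/-- **Reshaping a step**: a map of output constants preserving positivity along which the conclusion weakens.
[cite: Balaban1985BackgroundPropagators, Sect. B p.403] -/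
theorem Step.mono {C C' : Type} {p : C → Prop} {p' : C' → Prop} {O : C → ∀ i, (bg i).Cfg → ℝ → Prop}
    {O' : C' → ∀ i, (bg i).Cfg → ℝ → Prop} (f : C → C') (hp : ∀ c, p c → p' (f c))
    (hO : ∀ c i U α₁, p c → O c i U α₁ → O' (f c) i U α₁) (h : Step d c35 geo bg Gp GA Cinv C p O) :
    Step d c35 geo bg Gp GA Cinv C' p' O' := by
  intro B₀ δ₀ Bβ Bε Bεβ B₁ δ₁
  obtain ⟨M₀, a₁, a₀', c, hM₀, ha₁, ha₀', hpc, H⟩ := h B₀ δ₀ Bβ Bε Bεβ B₁ δ₁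
  exact ⟨M₀, a₁, a₀', f c, hM₀, ha₁, ha₀', hp c hpc, fun i hM α₀ hα₀ hMa U hU hT α₁ hα₁ ha =>
    hO c i U α₁ hpc (H i hM α₀ hα₀ hMa U hU hT α₁ hα₁ ha)⟩

/-! ## §3 The whole printed leaf from the block-steps -/

/-- **The six block-steps of one kernel family ⇒ its whole (3.42)–(3.47) step with ONE constant tuple**: B₀′ = the
largest of the three B₀'s, δ₀′ = the smallest of the five rates, the Hölder constants pointwise max (floored at 0) —
by §1 under the model signs. [cite: Balaban1985BackgroundPropagators, Thm 3.4 p.400 + (3.42)–(3.47) pp.397–398 + p.403] -/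
theorem stepAll_of_blocks {P : ∀ i, (geo i).Loc → Prop} (S : ∀ i, ModelSignsOn (geo i) (P i)) {K : ∀ i, B9.KernelFamily (geo i) (bg i)}
    (hE : StepE d c35 geo bg Gp GA Cinv K) (hL : StepL2 d c35 geo bg Gp GA Cinv K)
    (hG : StepGlob d c35 geo bg Gp GA Cinv K) (hH1 : StepH1 d c35 geo bg Gp GA Cinv K)
    (hE4 : StepE4 d c35 geo bg Gp GA Cinv K) (hH2 : StepH2 d c35 geo bg Gp GA Cinv K) :
    StepAll d c35 geo bg Gp GA Cinv K := by
  have h := ((((hE.and hL).and hG).and hH1).and hE4).and hH2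
  intro B₀ δ₀ Bβ Bε Bεβ B₁ δ₁
  obtain ⟨M₀, a₁, a₀', ⟨⟨⟨⟨⟨⟨BE, dE⟩, ⟨BL, dL⟩⟩, BG⟩, ⟨FH, dH⟩⟩, ⟨FE, d4⟩⟩, ⟨FH2, d2⟩⟩, hM₀, ha₁, ha₀',
    ⟨⟨⟨⟨⟨⟨hBE, hdE⟩, ⟨hBL, hdL⟩⟩, hBG⟩, hdH⟩, hd4⟩, hd2⟩, H⟩ := h B₀ δ₀ Bβ Bε Bεβ B₁ δ₁
  refine ⟨M₀, a₁, a₀',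
    ⟨max (max BE BL) BG, min (min (min (min dE dL) dH) d4) d2, fun β => max 0 (FH β), fun ε => max 0 (FE ε),
      fun ε β => max 0 (FH2 ε β)⟩,
    hM₀, ha₁, ha₀', ⟨lt_max_of_lt_left (lt_max_of_lt_left hBE),
      lt_min (lt_min (lt_min (lt_min hdE hdL) hdH) hd4) hd2⟩, ?_⟩
  intro i hM α₀ hα₀ hMa U hU hT α₁ hα₁ ha U' hU'
  obtain ⟨⟨⟨⟨⟨h1, h2⟩, h3⟩, h4⟩, h5⟩, h6⟩ := H i hM α₀ hα₀ hMa U hU hT α₁ hα₁ ha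
  have hB0 : 0 ≤ max (max BE BL) BG := le_trans hBE.le (le_trans (le_max_left _ _) (le_max_left _ _))
  have hδE : min (min (min (min dE dL) dH) d4) d2 ≤ dE :=
    le_trans (min_le_left _ _) (le_trans (min_le_left _ _) (le_trans (min_le_left _ _) (min_le_left _ _)))
  have hδL : min (min (min (min dE dL) dH) d4) d2 ≤ dL :=
    le_trans (min_le_left _ _) (le_trans (min_le_left _ _) (le_trans (min_le_left _ _) (min_le_right _ _)))
  have hδH : min (min (min (min dE dL) dH) d4) d2 ≤ dH :=
    le_trans (min_le_left _ _) (le_trans (min_le_left _ _) (min_le_right _ _))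
  have hδ4 : min (min (min (min dE dL) dH) d4) d2 ≤ d4 := le_trans (min_le_left _ _) (min_le_right _ _)
  have hδ2 : min (min (min (min dE dL) dH) d4) d2 ≤ d2 := min_le_right _ _
  exact ⟨⟨eBlock_mono (S i) (h1 U' hU') (le_trans (le_max_left _ _) (le_max_left _ _)) hB0 hδE,
      l2Block_mono (S i) (h2 U' hU') (le_trans (le_max_right _ _) (le_max_left _ _)) hB0 hδL,
      globBlock_mono (S i) (h3 U' hU') (le_max_right _ _)⟩,
    ⟨h1Block_mono (S i) (h4 U' hU') (fun β => le_max_right _ _) (fun β => le_max_left _ _) hδH,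
      e4Block_mono (S i) (h5 U' hU') (fun ε => le_max_right _ _) (fun ε => le_max_left _ _) hδ4,
      h2Block_mono (S i) (h6 U' hU') (fun ε β => le_max_right _ _) (fun ε β => le_max_left _ _) hδ2⟩⟩

/-- ★ **SECT. B AS THE WHOLE PRINTED LEAF `B9.SectBStepPrinted` FROM ITS PRINTED BLOCK-STEPS** (p. 407: *"Thus Theorem
3.4 is proved, assuming that Theorems 3.1–3.3 hold"*; p. 400: *"The extended operators satisfy all the inequalities of
Theorems 3.1–3.3 correspondingly"*): the analytic-extension step, the whole (3.42)–(3.47) steps for G′ and for G and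
the (3.48) step give the leaf, the constants of G′ and G merged into the leaf's shared tuple under the model signs.
NOTHING of Sect. B is asserted — the four steps are hypotheses of printed shape; the file's content is the quantifier
and constant bookkeeping. [cite: Balaban1985BackgroundPropagators, Thm 3.4 p.400 + Sect. B (3.62)–(3.67) pp.402–403 + (3.86) p.407] -/
theorem sectBStepPrinted_of_steps {P : ∀ i, (geo i).Loc → Prop} (S : ∀ i, ModelSignsOn (geo i) (P i))
    {IsAnalyticExt : ∀ i, B9.KernelFamily (geo i) (bg i) → (bg i).Cfg → ℝ → Prop}
    (hA : StepAnalytic d c35 geo bg Gp GA Cinv IsAnalyticExt) (hP : StepAll d c35 geo bg Gp GA Cinv Gp)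
    (hK : StepKer d c35 geo bg Gp GA Cinv Cinv) (hQ : StepAll d c35 geo bg Gp GA Cinv GA) :
    B9.SectBStepPrinted d c35 geo bg Gp GA Cinv IsAnalyticExt := by
  have h := ((hA.and hP).and hK).and hQ
  intro B₀ δ₀ Bβ Bε Bεβ B₁ δ₁
  obtain ⟨M₀, a₁, a₀', ⟨⟨⟨_, cP⟩, ⟨B₁', δ₁'⟩⟩, cQ⟩, hM₀, ha₁, ha₀', ⟨⟨⟨-, hP0, hPδ⟩, hB₁', hδ₁'⟩, hQ0, hQδ⟩, H⟩ :=
    h B₀ δ₀ Bβ Bε Bεβ B₁ δ₁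
  refine ⟨M₀, a₁, a₀', max cP.B₀ cQ.B₀, min cP.δ₀ cQ.δ₀, fun β => max 0 (max (cP.Bβ β) (cQ.Bβ β)),
    fun ε => max 0 (max (cP.Bε ε) (cQ.Bε ε)), fun ε β => max 0 (max (cP.Bεβ ε β) (cQ.Bεβ ε β)), B₁', δ₁',
    hM₀, ha₁, ha₀', lt_max_of_lt_left hP0, lt_min hPδ hQδ, hB₁', hδ₁', ?_⟩
  intro i hM α₀ hα₀ hMa U hU hT α₁ hα₁ ha
  obtain ⟨⟨⟨hAi, hPi⟩, hKi⟩, hQi⟩ := H i hM α₀ hα₀ hMa U hU hT α₁ hα₁ ha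
  refine ⟨hAi.1, hAi.2, fun U' hU' => ?_⟩
  obtain ⟨hP1, hP2⟩ := hPi U' hU'
  obtain ⟨hQ1, hQ2⟩ := hQi U' hU'
  have hB0 : 0 ≤ max cP.B₀ cQ.B₀ := le_trans hP0.le (le_max_left _ _)
  refine ⟨⟨ineq342_346_347_mono (S i) hP1 (le_max_left _ _) hB0 (min_le_left _ _),
      ineq343_345_mono (S i) hP2 (fun β => le_trans (le_max_left _ _) (le_max_right _ _)) (fun β => le_max_left _ _)
        (fun ε => le_trans (le_max_left _ _) (le_max_right _ _)) (fun ε => le_max_left _ _)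
        (fun ε β => le_trans (le_max_left _ _) (le_max_right _ _)) (fun ε β => le_max_left _ _) (min_le_left _ _)⟩,
    hKi U' hU',
    ⟨ineq342_346_347_mono (S i) hQ1 (le_max_right _ _) hB0 (min_le_right _ _),
      ineq343_345_mono (S i) hQ2 (fun β => le_trans (le_max_right _ _) (le_max_right _ _)) (fun β => le_max_left _ _)
        (fun ε => le_trans (le_max_right _ _) (le_max_right _ _)) (fun ε => le_max_left _ _)
        (fun ε β => le_trans (le_max_right _ _) (le_max_right _ _)) (fun ε β => le_max_left _ _)
        (min_le_right _ _)⟩⟩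

/-- ★ **`B9.SectBStepPrinted` FROM THE FOURTEEN PRINTED BLOCK-STEPS** — the analytic-extension step, the six entry
block-steps (3.42) ∕ (3.46) ∕ (3.47) ∕ (3.43) ∕ (3.44) ∕ (3.45) for G′(U′U), the kernel step (3.48), and the six for G(U′U)
(`stepAll_of_blocks` twice + `sectBStepPrinted_of_steps`).  This is the shape in which pins over the tree's Sect. B
programme (`B9Thm34AllFinal.thm34_all_final`: (3.42) for G′, G and (3.48); `B9Thm34HolderAllFinal`: (3.43);
`B9Ineq346L2Final`: (3.46)₁,₂,₃,₅; `B9Ineq347AllEntries`: (3.47)) can discharge `hB` block by block; the steps (3.44),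
(3.45) and the members (3.46)₄,₆ at U′U are the cell's open items (GAPS G-B9-02).  Nothing of print asserted.
[cite: Balaban1985BackgroundPropagators, Thm 3.4 p.400 + Sect. B pp.402–407] -/
theorem sectBStepPrinted_of_blockSteps {P : ∀ i, (geo i).Loc → Prop} (S : ∀ i, ModelSignsOn (geo i) (P i))
    {IsAnalyticExt : ∀ i, B9.KernelFamily (geo i) (bg i) → (bg i).Cfg → ℝ → Prop}
    (hA : StepAnalytic d c35 geo bg Gp GA Cinv IsAnalyticExt)
    (hEp : StepE d c35 geo bg Gp GA Cinv Gp) (hLp : StepL2 d c35 geo bg Gp GA Cinv Gp)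
    (hGp : StepGlob d c35 geo bg Gp GA Cinv Gp) (hH1p : StepH1 d c35 geo bg Gp GA Cinv Gp)
    (hE4p : StepE4 d c35 geo bg Gp GA Cinv Gp) (hH2p : StepH2 d c35 geo bg Gp GA Cinv Gp)
    (hK : StepKer d c35 geo bg Gp GA Cinv Cinv)
    (hEa : StepE d c35 geo bg Gp GA Cinv GA) (hLa : StepL2 d c35 geo bg Gp GA Cinv GA)
    (hGa : StepGlob d c35 geo bg Gp GA Cinv GA) (hH1a : StepH1 d c35 geo bg Gp GA Cinv GA)
    (hE4a : StepE4 d c35 geo bg Gp GA Cinv GA) (hH2a : StepH2 d c35 geo bg Gp GA Cinv GA) :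
    B9.SectBStepPrinted d c35 geo bg Gp GA Cinv IsAnalyticExt :=
  sectBStepPrinted_of_steps S hA (stepAll_of_blocks S hEp hLp hGp hH1p hE4p hH2p) hK
    (stepAll_of_blocks S hEa hLa hGa hH1a hE4a hH2a)

/-! ## §4 (v1.1) The L² block-step (3.46) split by member

The tree's Sect. B programme proves (3.46) at U′U member by member and only for the members ₁,₂,₃,₅ (`B9Ineq346L2Final`,
HONEST SCOPE (a): ₄,₆ need the L² regularity of [4] and are open, GAPS G-B9-02 (O′)).  So the pinnable unit for (3.46)
is ONE MEMBER n : Fin 6 of `B9FromB6.L2Block`; `stepL2_of_members` recombines the six member-steps into `StepL2`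
(constants merged under the model signs). -/

/-- **Block-step (3.46), member `n`, for K(U′U)** (‖h·(n-th word of K(U′U))·λ‖ ≦ B₀′[(Lʲη)², Lʲη, Lʲη, 1, 1, 1]ₙ|h|
e^{−δ₀′d(y,y′)}‖λ‖, supp h ⊂ Δ(y), supp λ ⊂ Δ(y′)); members ₄,₆ (`n = 3, 5`) at U′U are the open ones.
[cite: Balaban1985BackgroundPropagators, (3.46) p.398 + p.402] -/
def StepL2n (d : ℕ) (c35 : ℝ) (geo : I → B9.Geometry) (bg : I → B9.Backgrounds)
    (Gp GA : ∀ i, B9.KernelFamily (geo i) (bg i)) (Cinv : ∀ i, B9.SiteKernel (geo i) (bg i))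
    (K : ∀ i, B9.KernelFamily (geo i) (bg i)) (n : Fin 6) : Prop :=
  Step d c35 geo bg Gp GA Cinv (ℝ × ℝ) (fun c => 0 < c.1 ∧ 0 < c.2)
    (fun c i U α₁ => ∀ U' : (bg i).Cfg, (bg i).Cplx337 α₁ U U' →
      ∀ (lam : (geo i).Loc) (h : (geo i).Cut) (y y' : (geo i).Site), (geo i).cutIn h y → (geo i).suppIn lam y' →
        (K i).l2 n ((bg i).mul U' U) lam h ≤
          c.1 * B9.pref6 ((geo i).len y) n * (geo i).cutSup h * Real.exp (-(c.2 * (geo i).dist y y')) *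
            (geo i).l2Norm lam)

/-- **The six member-steps of (3.46) ⇒ the block-step `StepL2`** (B₀′ = the largest, δ₀′ = the smallest of the six;
weakening by `B9FromB6.weaken5` under the model signs). [cite: Balaban1985BackgroundPropagators, (3.46) p.398 + p.403] -/
theorem stepL2_of_members {P : ∀ i, (geo i).Loc → Prop} (S : ∀ i, ModelSignsOn (geo i) (P i))
    {K : ∀ i, B9.KernelFamily (geo i) (bg i)} (h : ∀ n : Fin 6, StepL2n d c35 geo bg Gp GA Cinv K n) :
    StepL2 d c35 geo bg Gp GA Cinv K := by
  have h6 := (((((h 0).and (h 1)).and (h 2)).and (h 3)).and (h 4)).and (h 5)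
  intro B₀ δ₀ Bβ Bε Bεβ B₁ δ₁
  obtain ⟨M₀, a₁, a₀', ⟨⟨⟨⟨⟨⟨b0, e0⟩, ⟨b1, e1⟩⟩, ⟨b2, e2⟩⟩, ⟨b3, e3⟩⟩, ⟨b4, e4⟩⟩, ⟨b5, e5⟩⟩, hM₀, ha₁, ha₀',
    ⟨⟨⟨⟨⟨⟨hb0, he0⟩, ⟨_, he1⟩⟩, ⟨_, he2⟩⟩, ⟨_, he3⟩⟩, ⟨_, he4⟩⟩, ⟨_, he5⟩⟩, H⟩ :=
    h6 B₀ δ₀ Bβ Bε Bεβ B₁ δ₁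
  refine ⟨M₀, a₁, a₀', (max (max (max (max (max b0 b1) b2) b3) b4) b5,
    min (min (min (min (min e0 e1) e2) e3) e4) e5), hM₀, ha₁, ha₀',
    ⟨lt_max_of_lt_left (lt_max_of_lt_left (lt_max_of_lt_left (lt_max_of_lt_left (lt_max_of_lt_left hb0)))),
      lt_min (lt_min (lt_min (lt_min (lt_min he0 he1) he2) he3) he4) he5⟩, ?_⟩
  intro i hM α₀ hα₀ hMa U hU hT α₁ hα₁ ha U' hU' n lam hc y y' hcut hs
  obtain ⟨⟨⟨⟨⟨k0, k1⟩, k2⟩, k3⟩, k4⟩, k5⟩ := H i hM α₀ hα₀ hMa U hU hT α₁ hα₁ ha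
  have hB : 0 ≤ max (max (max (max (max b0 b1) b2) b3) b4) b5 :=
    le_trans hb0.le (le_trans (le_max_left _ _) (le_trans (le_max_left _ _) (le_trans (le_max_left _ _)
      (le_trans (le_max_left _ _) (le_max_left _ _)))))
  have w := fun (m : Fin 6) (b e : ℝ) (hb : b ≤ max (max (max (max (max b0 b1) b2) b3) b4) b5)
      (he : min (min (min (min (min e0 e1) e2) e3) e4) e5 ≤ e)
      (k : (K i).l2 m ((bg i).mul U' U) lam hc ≤
        b * B9.pref6 ((geo i).len y) m * (geo i).cutSup hc * Real.exp (-(e * (geo i).dist y y')) *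
          (geo i).l2Norm lam) =>
    weaken5 k hb hB (pref6_nonneg ((S i).len_nonneg y) m) ((S i).cutSup_nonneg hc) ((S i).l2Norm_nonneg lam) he
      ((S i).dist_nonneg y y')
  fin_cases n
  · exact w 0 b0 e0 (le_trans (le_max_left _ _) (le_trans (le_max_left _ _) (le_trans (le_max_left _ _)
      (le_trans (le_max_left _ _) (le_max_left _ _))))) (le_trans (min_le_left _ _) (le_trans (min_le_left _ _)
      (le_trans (min_le_left _ _) (le_trans (min_le_left _ _) (min_le_left _ _))))) (k0 U' hU' lam hc y y' hcut hs)
  · exact w 1 b1 e1 (le_trans (le_max_right _ _) (le_trans (le_max_left _ _) (le_trans (le_max_left _ _)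
      (le_trans (le_max_left _ _) (le_max_left _ _))))) (le_trans (min_le_left _ _) (le_trans (min_le_left _ _)
      (le_trans (min_le_left _ _) (le_trans (min_le_left _ _) (min_le_right _ _))))) (k1 U' hU' lam hc y y' hcut hs)
  · exact w 2 b2 e2 (le_trans (le_max_right _ _) (le_trans (le_max_left _ _) (le_trans (le_max_left _ _)
      (le_max_left _ _)))) (le_trans (min_le_left _ _) (le_trans (min_le_left _ _) (le_trans (min_le_left _ _)
      (min_le_right _ _)))) (k2 U' hU' lam hc y y' hcut hs)
  · exact w 3 b3 e3 (le_trans (le_max_right _ _) (le_trans (le_max_left _ _) (le_max_left _ _)))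
      (le_trans (min_le_left _ _) (le_trans (min_le_left _ _) (min_le_right _ _))) (k3 U' hU' lam hc y y' hcut hs)
  · exact w 4 b4 e4 (le_trans (le_max_right _ _) (le_max_left _ _)) (le_trans (min_le_left _ _) (min_le_right _ _))
      (k4 U' hU' lam hc y y' hcut hs)
  · exact w 5 b5 e5 (le_max_right _ _) (min_le_right _ _) (k5 U' hU' lam hc y y' hcut hs)

end Steps

/-! ## §5 (v1.2) The POSITIVE-INPUT block-steps — the units a letters instance can inhabit — and the printed leaf from
them GIVEN Theorems 3.2 ∕ 3.3; CORRECTION of the v1 ∕ v1.1 sentences on «GAPS G-B9-02»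

CORRECTION (seat `pub-ymgap-dag-n06-c` g2, 2026-08-26).  The sentences in the v1 ∕ v1.1 docstrings of this file saying that
(3.44), (3.45) and the members (3.46)₄,₆ at U′U are «NOT in the tree — GAPS G-B9-02» are OUT OF DATE: the cell's Sect. B
programme (seat r06) proved them at its final level on 2026-08-22∕23 (its `B9-CLOSURE.md` v2.2–v2.9: «§5 item 3: nothing
open») — (3.44)∕(3.45) for G′(U′U): `B9Thm34HolderInputGp.thm34_Gp_holderInput_final` (print's quantifier order:
`B9Thm34HolderInputGpUniform.thm34_Gp_holderInput_uniform`), for G(U′U): `B9Thm34HolderInputG.thm34_all_holderInput_final`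
(`B9Thm34HolderInputGUniform.thm34_all_holderInput_uniform`); (3.46)₄ (two left differences):
`B9Ineq346L2SecondDiff.thm34_Gp_l2_second_final` ∕ `thm34_G_l2_second_final` (`B9Ineq346L2SecondDiffUniform`); (3.46)₆ (two
right differences): `B9Ineq346L2RightDiff.thm34_Gp_l2_right_final` (`B9Ineq346L2RightDiffUniform`),
`B9Ineq346L2RightDiffG.thm34_G_l2_right_final` (`B9Ineq346L2RightDiffGUniform`).  So EVERY block-step of §2–§4 has an r06
final-level theorem behind it (besides those: `B9Thm34SectBUniform.thm34_Gp_uniform` ∕ `thm34_Cinv_uniform`,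
`B9Thm34GUniform.thm34_G_clause_uniform`, `B9Thm34HolderAllUniform.thm34_all_holder_uniform`, `B9Ineq346L2Uniform`,
`B9Ineq347AllEntries`, `B9Eq386NeumannAnalytic`), and what separates the steps from inhabitation is the LETTERS DICTIONARY
between the readings of `B9.KernelFamily` and r06's `B6RandomWalk.HasMajorant` ∕ kernel ∕ L² letters over
`Module.End ℝ (S × ι → ℝ)` — an instance-level act, not a Literature-side debt.  The DECLARATIONS of §1–§4 are unaffected
(hypothesis schemas; none asserts anything open or closed).

THE LOCATED POINT THIS SECTION REPAIRS.  `Step` (§2) — like the cell's leaf `B9.SectBStepPrinted` — quantifies over ALL input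
tuples (B₀, δ₀, B₀(·), B′₀(·), B′₀(·,·), B₁, δ₁), including NON-POSITIVE RATES δ₀ ≦ 0, δ₁ ≦ 0, and asks for positive output
rates.  For such a tuple the hypothesis `B9.Thms31to33IneqAt … U` carries no decay, while the conclusion at U′ = 1 (a member of
the class (3.37)) is the decay of K(U) itself: the degenerate tuples make a block-step absorb the conclusion of Theorem 3.1,
which no Sect.-B transfer supplies (r06's `thm34_Gp_uniform` needs `0 < δ₀`, `0 < B_G`).  The unit a letters instance CAN
inhabit from the r06 theorems is the POSITIVE-INPUT step `StepPos` (guards `0 < B₀`, `0 < δ₀`, `0 < B₁`, `0 < δ₁` before the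
thresholds; every `Step` is a `StepPos`, `stepPos_of_step`), and the printed leaf follows from the positive-input steps GIVEN
Theorems 3.2 and 3.3 at U (p. 407: *"Thus Theorem 3.4 is proved, assuming that Theorems 3.1–3.3 hold"*) — thresholds and
output constants are read at THEIR positive constants, the given tuple being by-passed (`sectBStepPrinted_of_posSteps`,
`sectBStepPrinted_of_posBlockSteps`).  At the record Theorems 3.2 ∕ 3.3 are available by name from the obligations t37, t39,
t310, hsum, hksum (`B9.thm32_of_thm39`, `B9.thm33_of_thm37_310`).  Nothing of print asserted; count-neutral. -/

section PosSteps

variable {I : Type} (d : ℕ) (c35 : ℝ) (geo : I → B9.Geometry) (bg : I → B9.Backgrounds)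
  (Gp GA : ∀ i, B9.KernelFamily (geo i) (bg i)) (Cinv : ∀ i, B9.SiteKernel (geo i) (bg i))

/-- **The printed quantifier prefix of Sect. B for POSITIVE input constants** — `Step` with the guards `0 < B₀`, `0 < δ₀`,
`0 < B₁`, `0 < δ₁` (Theorem 3.1 ∕ 3.2: *"positive constants M₁, δ₀, a₀, B₀"*, p. 397; *"with the same constants"*, p. 398)
before the thresholds: the unit a Sect.-B transfer can inhabit. [cite: Balaban1985BackgroundPropagators, Thm 3.1 p.397 + Sect. B pp.400–407] -/
def StepPos (C : Type) (pos : C → Prop) (Out : C → ∀ i, (bg i).Cfg → ℝ → Prop) : Prop :=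
  ∀ (B₀ δ₀ : ℝ) (Bβ Bε : ℝ → ℝ) (Bεβ : ℝ → ℝ → ℝ) (B₁ δ₁ : ℝ), 0 < B₀ → 0 < δ₀ → 0 < B₁ → 0 < δ₁ →
    ∃ M₀ a₁ a₀' : ℝ, ∃ c : C, 0 < M₀ ∧ 0 < a₁ ∧ 0 < a₀' ∧ pos c ∧
      ∀ i : I, M₀ ≤ (geo i).M → ∀ α₀ : ℝ, 0 < α₀ → (geo i).M * α₀ ≤ a₀' →
        ∀ U : (bg i).Cfg, (bg i).Reg335 c35 α₀ U →
          B9.Thms31to33IneqAt d (Gp i) (GA i) (Cinv i) B₀ δ₀ Bβ Bε Bεβ B₁ δ₁ U →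
            ∀ α₁ : ℝ, 0 < α₁ → α₁ ≤ a₁ → Out c i U α₁

/-- **Positive-input block-step (3.42) for K(U′U)** (cf. `StepE`). [cite: Balaban1985BackgroundPropagators, (3.42) p.397 + (3.64) p.402 + (3.86) p.407] -/
def StepEPos (K : ∀ i, B9.KernelFamily (geo i) (bg i)) : Prop :=
  StepPos d c35 geo bg Gp GA Cinv (ℝ × ℝ) (fun c => 0 < c.1 ∧ 0 < c.2)
    (fun c i U α₁ => ∀ U' : (bg i).Cfg, (bg i).Cplx337 α₁ U U' → EBlock (K i) c.1 c.2 ((bg i).mul U' U))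

/-- **Positive-input block-step (3.46) for K(U′U)** (all six L² members; cf. `StepL2`). [cite: Balaban1985BackgroundPropagators, (3.46) p.398 + p.402] -/
def StepL2Pos (K : ∀ i, B9.KernelFamily (geo i) (bg i)) : Prop :=
  StepPos d c35 geo bg Gp GA Cinv (ℝ × ℝ) (fun c => 0 < c.1 ∧ 0 < c.2)
    (fun c i U α₁ => ∀ U' : (bg i).Cfg, (bg i).Cplx337 α₁ U U' → L2Block (K i) c.1 c.2 ((bg i).mul U' U))

/-- **Positive-input block-step (3.46), member `n`, for K(U′U)** (cf. `StepL2n`; the r06 theorems are per member: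
`B9Ineq346L2Uniform` ₁,₂,₃,₅, `B9Ineq346L2SecondDiffUniform` ₄, `B9Ineq346L2RightDiffUniform` ∕ `…GUniform` ₆).
[cite: Balaban1985BackgroundPropagators, (3.46) p.398 + p.402] -/
def StepL2nPos (K : ∀ i, B9.KernelFamily (geo i) (bg i)) (n : Fin 6) : Prop :=
  StepPos d c35 geo bg Gp GA Cinv (ℝ × ℝ) (fun c => 0 < c.1 ∧ 0 < c.2)
    (fun c i U α₁ => ∀ U' : (bg i).Cfg, (bg i).Cplx337 α₁ U U' →
      ∀ (lam : (geo i).Loc) (h : (geo i).Cut) (y y' : (geo i).Site), (geo i).cutIn h y → (geo i).suppIn lam y' →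
        (K i).l2 n ((bg i).mul U' U) lam h ≤
          c.1 * B9.pref6 ((geo i).len y) n * (geo i).cutSup h * Real.exp (-(c.2 * (geo i).dist y y')) *
            (geo i).l2Norm lam)

/-- **Positive-input block-step (3.47) for K(U′U)** (cf. `StepGlob`). [cite: Balaban1985BackgroundPropagators, (3.47) p.398 + p.402] -/
def StepGlobPos (K : ∀ i, B9.KernelFamily (geo i) (bg i)) : Prop :=
  StepPos d c35 geo bg Gp GA Cinv ℝ (fun c => 0 < c)
    (fun c i U α₁ => ∀ U' : (bg i).Cfg, (bg i).Cplx337 α₁ U U' → GlobBlock (K i) c ((bg i).mul U' U))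

/-- **Positive-input block-step (3.43) for K(U′U)** (cf. `StepH1`). [cite: Balaban1985BackgroundPropagators, (3.43) p.398 + p.402] -/
def StepH1Pos (K : ∀ i, B9.KernelFamily (geo i) (bg i)) : Prop :=
  StepPos d c35 geo bg Gp GA Cinv ((ℝ → ℝ) × ℝ) (fun c => 0 < c.2)
    (fun c i U α₁ => ∀ U' : (bg i).Cfg, (bg i).Cplx337 α₁ U U' → H1Block (K i) c.1 c.2 ((bg i).mul U' U))

/-- **Positive-input block-step (3.44) for K(U′U)** (cf. `StepE4`; in the tree at the r06 final level, see the §5 header).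
[cite: Balaban1985BackgroundPropagators, (3.44) p.398 + p.402] -/
def StepE4Pos (K : ∀ i, B9.KernelFamily (geo i) (bg i)) : Prop :=
  StepPos d c35 geo bg Gp GA Cinv ((ℝ → ℝ) × ℝ) (fun c => 0 < c.2)
    (fun c i U α₁ => ∀ U' : (bg i).Cfg, (bg i).Cplx337 α₁ U U' → E4Block (K i) c.1 c.2 ((bg i).mul U' U))

/-- **Positive-input block-step (3.45) for K(U′U)** (cf. `StepH2`; in the tree at the r06 final level, see the §5 header).
[cite: Balaban1985BackgroundPropagators, (3.45) p.398 + p.402] -/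
def StepH2Pos (K : ∀ i, B9.KernelFamily (geo i) (bg i)) : Prop :=
  StepPos d c35 geo bg Gp GA Cinv ((ℝ → ℝ → ℝ) × ℝ) (fun c => 0 < c.2)
    (fun c i U α₁ => ∀ U' : (bg i).Cfg, (bg i).Cplx337 α₁ U U' → H2Block (K i) c.1 c.2 ((bg i).mul U' U))

/-- **Positive-input block-step (3.48) for (Q′G′²Q′*)⁻¹(U′U)** (cf. `StepKer`). [cite: Balaban1985BackgroundPropagators, (3.48) p.398 + (3.65)–(3.67) p.403] -/
def StepKerPos (C : ∀ i, B9.SiteKernel (geo i) (bg i)) : Prop :=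
  StepPos d c35 geo bg Gp GA Cinv (ℝ × ℝ) (fun c => 0 < c.1 ∧ 0 < c.2)
    (fun c i U α₁ => ∀ U' : (bg i).Cfg, (bg i).Cplx337 α₁ U U' → ∀ y y' : (geo i).Site,
      |(C i).ker ((bg i).mul U' U) y y'| ≤
        c.1 * ((geo i).len y) ^ (-(4 : ℝ)) * ((geo i).len y') ^ (-(d : ℝ)) * Real.exp (-(c.2 * (geo i).dist y y')))

/-- **Positive-input analytic-extension step** (cf. `StepAnalytic`). [cite: Balaban1985BackgroundPropagators, Thm 3.4 p.400 + (3.62)–(3.63) p.402 + (3.86) p.407] -/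
def StepAnalyticPos (IsAnalyticExt : ∀ i, B9.KernelFamily (geo i) (bg i) → (bg i).Cfg → ℝ → Prop) : Prop :=
  StepPos d c35 geo bg Gp GA Cinv PUnit (fun _ => True)
    (fun _ i U α₁ => IsAnalyticExt i (Gp i) U α₁ ∧ IsAnalyticExt i (GA i) U α₁)

/-- **Positive-input whole (3.42)–(3.47) step for K(U′U)** with one constant tuple (cf. `StepAll`).
[cite: Balaban1985BackgroundPropagators, Thm 3.4 p.400 + (3.42)–(3.47) pp.397–398] -/
def StepAllPos (K : ∀ i, B9.KernelFamily (geo i) (bg i)) : Prop :=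
  StepPos d c35 geo bg Gp GA Cinv Consts (fun c => 0 < c.B₀ ∧ 0 < c.δ₀)
    (fun c i U α₁ => ∀ U' : (bg i).Cfg, (bg i).Cplx337 α₁ U U' →
      B9.Ineq342_346_347 (K i) c.B₀ c.δ₀ ((bg i).mul U' U) ∧
        B9.Ineq343_345 (K i) c.Bβ c.Bε c.Bεβ c.δ₀ ((bg i).mul U' U))

variable {d c35 geo bg Gp GA Cinv}

/-- Every step is a positive-input step (the guards are simply not used). [cite: Balaban1985BackgroundPropagators, Sect. B p.402] -/
theorem stepPos_of_step {C : Type} {p : C → Prop} {O : C → ∀ i, (bg i).Cfg → ℝ → Prop}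
    (h : Step d c35 geo bg Gp GA Cinv C p O) : StepPos d c35 geo bg Gp GA Cinv C p O :=
  fun B₀ δ₀ Bβ Bε Bεβ B₁ δ₁ _ _ _ _ => h B₀ δ₀ Bβ Bε Bεβ B₁ δ₁

/-- **Two positive-input steps ⇒ one** (cf. `Step.and`). [cite: Balaban1985BackgroundPropagators, Sect. B p.402 + p.407] -/
theorem StepPos.and {C₁ C₂ : Type} {p₁ : C₁ → Prop} {p₂ : C₂ → Prop} {O₁ : C₁ → ∀ i, (bg i).Cfg → ℝ → Prop}
    {O₂ : C₂ → ∀ i, (bg i).Cfg → ℝ → Prop} (h₁ : StepPos d c35 geo bg Gp GA Cinv C₁ p₁ O₁)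
    (h₂ : StepPos d c35 geo bg Gp GA Cinv C₂ p₂ O₂) :
    StepPos d c35 geo bg Gp GA Cinv (C₁ × C₂) (fun c => p₁ c.1 ∧ p₂ c.2)
      (fun c i U α₁ => O₁ c.1 i U α₁ ∧ O₂ c.2 i U α₁) := by
  intro B₀ δ₀ Bβ Bε Bεβ B₁ δ₁ hB₀ hδ₀ hB₁ hδ₁
  obtain ⟨M₁, a₁, b₁, c₁, hM₁, ha₁, hb₁, hp₁, H₁⟩ := h₁ B₀ δ₀ Bβ Bε Bεβ B₁ δ₁ hB₀ hδ₀ hB₁ hδ₁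
  obtain ⟨M₂, a₂, b₂, c₂, _hM₂, ha₂, hb₂, hp₂, H₂⟩ := h₂ B₀ δ₀ Bβ Bε Bεβ B₁ δ₁ hB₀ hδ₀ hB₁ hδ₁
  refine ⟨max M₁ M₂, min a₁ a₂, min b₁ b₂, (c₁, c₂), lt_max_of_lt_left hM₁, lt_min ha₁ ha₂, lt_min hb₁ hb₂,
    ⟨hp₁, hp₂⟩, ?_⟩
  intro i hM α₀ hα₀ hMa U hU hT α₁ hα₁ ha
  exact ⟨H₁ i (le_trans (le_max_left _ _) hM) α₀ hα₀ (le_trans hMa (min_le_left _ _)) U hU hT α₁ hα₁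
      (le_trans ha (min_le_left _ _)),
    H₂ i (le_trans (le_max_right _ _) hM) α₀ hα₀ (le_trans hMa (min_le_right _ _)) U hU hT α₁ hα₁
      (le_trans ha (min_le_right _ _))⟩

/-- **Reshaping a positive-input step** (cf. `Step.mono`). [cite: Balaban1985BackgroundPropagators, Sect. B p.403] -/
theorem StepPos.mono {C C' : Type} {p : C → Prop} {p' : C' → Prop} {O : C → ∀ i, (bg i).Cfg → ℝ → Prop}
    {O' : C' → ∀ i, (bg i).Cfg → ℝ → Prop} (f : C → C') (hp : ∀ c, p c → p' (f c))
    (hO : ∀ c i U α₁, p c → O c i U α₁ → O' (f c) i U α₁) (h : StepPos d c35 geo bg Gp GA Cinv C p O) :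
    StepPos d c35 geo bg Gp GA Cinv C' p' O' := by
  intro B₀ δ₀ Bβ Bε Bεβ B₁ δ₁ hB₀ hδ₀ hB₁ hδ₁
  obtain ⟨M₀, a₁, a₀', c, hM₀, ha₁, ha₀', hpc, H⟩ := h B₀ δ₀ Bβ Bε Bεβ B₁ δ₁ hB₀ hδ₀ hB₁ hδ₁
  exact ⟨M₀, a₁, a₀', f c, hM₀, ha₁, ha₀', hp c hpc, fun i hM α₀ hα₀ hMa U hU hT α₁ hα₁ ha =>
    hO c i U α₁ hpc (H i hM α₀ hα₀ hMa U hU hT α₁ hα₁ ha)⟩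

/-- **The six positive-input block-steps of one kernel family ⇒ its whole positive-input step** (cf. `stepAll_of_blocks`;
constants merged by §1 under the model signs). [cite: Balaban1985BackgroundPropagators, Thm 3.4 p.400 + (3.42)–(3.47) pp.397–398 + p.403] -/
theorem stepAllPos_of_blocks {P : ∀ i, (geo i).Loc → Prop} (S : ∀ i, ModelSignsOn (geo i) (P i))
    {K : ∀ i, B9.KernelFamily (geo i) (bg i)}
    (hE : StepEPos d c35 geo bg Gp GA Cinv K) (hL : StepL2Pos d c35 geo bg Gp GA Cinv K)
    (hG : StepGlobPos d c35 geo bg Gp GA Cinv K) (hH1 : StepH1Pos d c35 geo bg Gp GA Cinv K)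
    (hE4 : StepE4Pos d c35 geo bg Gp GA Cinv K) (hH2 : StepH2Pos d c35 geo bg Gp GA Cinv K) :
    StepAllPos d c35 geo bg Gp GA Cinv K := by
  have h := ((((hE.and hL).and hG).and hH1).and hE4).and hH2
  intro B₀ δ₀ Bβ Bε Bεβ B₁ δ₁ hB₀ hδ₀ hB₁ hδ₁
  obtain ⟨M₀, a₁, a₀', ⟨⟨⟨⟨⟨⟨BE, dE⟩, ⟨BL, dL⟩⟩, BG⟩, ⟨FH, dH⟩⟩, ⟨FE, d4⟩⟩, ⟨FH2, d2⟩⟩, hM₀, ha₁, ha₀',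
    ⟨⟨⟨⟨⟨⟨hBE, hdE⟩, ⟨hBL, hdL⟩⟩, hBG⟩, hdH⟩, hd4⟩, hd2⟩, H⟩ := h B₀ δ₀ Bβ Bε Bεβ B₁ δ₁ hB₀ hδ₀ hB₁ hδ₁
  refine ⟨M₀, a₁, a₀',
    ⟨max (max BE BL) BG, min (min (min (min dE dL) dH) d4) d2, fun β => max 0 (FH β), fun ε => max 0 (FE ε),
      fun ε β => max 0 (FH2 ε β)⟩,
    hM₀, ha₁, ha₀', ⟨lt_max_of_lt_left (lt_max_of_lt_left hBE),
      lt_min (lt_min (lt_min (lt_min hdE hdL) hdH) hd4) hd2⟩, ?_⟩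
  intro i hM α₀ hα₀ hMa U hU hT α₁ hα₁ ha U' hU'
  obtain ⟨⟨⟨⟨⟨h1, h2⟩, h3⟩, h4⟩, h5⟩, h6⟩ := H i hM α₀ hα₀ hMa U hU hT α₁ hα₁ ha
  have hB0 : 0 ≤ max (max BE BL) BG := le_trans hBE.le (le_trans (le_max_left _ _) (le_max_left _ _))
  have hδE : min (min (min (min dE dL) dH) d4) d2 ≤ dE :=
    le_trans (min_le_left _ _) (le_trans (min_le_left _ _) (le_trans (min_le_left _ _) (min_le_left _ _)))
  have hδL : min (min (min (min dE dL) dH) d4) d2 ≤ dL :=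
    le_trans (min_le_left _ _) (le_trans (min_le_left _ _) (le_trans (min_le_left _ _) (min_le_right _ _)))
  have hδH : min (min (min (min dE dL) dH) d4) d2 ≤ dH :=
    le_trans (min_le_left _ _) (le_trans (min_le_left _ _) (min_le_right _ _))
  have hδ4 : min (min (min (min dE dL) dH) d4) d2 ≤ d4 := le_trans (min_le_left _ _) (min_le_right _ _)
  have hδ2 : min (min (min (min dE dL) dH) d4) d2 ≤ d2 := min_le_right _ _
  exact ⟨⟨eBlock_mono (S i) (h1 U' hU') (le_trans (le_max_left _ _) (le_max_left _ _)) hB0 hδE,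
      l2Block_mono (S i) (h2 U' hU') (le_trans (le_max_right _ _) (le_max_left _ _)) hB0 hδL,
      globBlock_mono (S i) (h3 U' hU') (le_max_right _ _)⟩,
    ⟨h1Block_mono (S i) (h4 U' hU') (fun β => le_max_right _ _) (fun β => le_max_left _ _) hδH,
      e4Block_mono (S i) (h5 U' hU') (fun ε => le_max_right _ _) (fun ε => le_max_left _ _) hδ4,
      h2Block_mono (S i) (h6 U' hU') (fun ε β => le_max_right _ _) (fun ε β => le_max_left _ _) hδ2⟩⟩

/-- **The six positive-input member-steps of (3.46) ⇒ the positive-input block-step `StepL2Pos`** (cf. `stepL2_of_members`).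
[cite: Balaban1985BackgroundPropagators, (3.46) p.398 + p.403] -/
theorem stepL2Pos_of_members {P : ∀ i, (geo i).Loc → Prop} (S : ∀ i, ModelSignsOn (geo i) (P i))
    {K : ∀ i, B9.KernelFamily (geo i) (bg i)} (h : ∀ n : Fin 6, StepL2nPos d c35 geo bg Gp GA Cinv K n) :
    StepL2Pos d c35 geo bg Gp GA Cinv K := by
  have h6 := (((((h 0).and (h 1)).and (h 2)).and (h 3)).and (h 4)).and (h 5)
  intro B₀ δ₀ Bβ Bε Bεβ B₁ δ₁ hB₀ hδ₀ hB₁ hδ₁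
  obtain ⟨M₀, a₁, a₀', ⟨⟨⟨⟨⟨⟨b0, e0⟩, ⟨b1, e1⟩⟩, ⟨b2, e2⟩⟩, ⟨b3, e3⟩⟩, ⟨b4, e4⟩⟩, ⟨b5, e5⟩⟩, hM₀, ha₁, ha₀',
    ⟨⟨⟨⟨⟨⟨hb0, he0⟩, ⟨_, he1⟩⟩, ⟨_, he2⟩⟩, ⟨_, he3⟩⟩, ⟨_, he4⟩⟩, ⟨_, he5⟩⟩, H⟩ :=
    h6 B₀ δ₀ Bβ Bε Bεβ B₁ δ₁ hB₀ hδ₀ hB₁ hδ₁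
  refine ⟨M₀, a₁, a₀', (max (max (max (max (max b0 b1) b2) b3) b4) b5,
    min (min (min (min (min e0 e1) e2) e3) e4) e5), hM₀, ha₁, ha₀',
    ⟨lt_max_of_lt_left (lt_max_of_lt_left (lt_max_of_lt_left (lt_max_of_lt_left (lt_max_of_lt_left hb0)))),
      lt_min (lt_min (lt_min (lt_min (lt_min he0 he1) he2) he3) he4) he5⟩, ?_⟩
  intro i hM α₀ hα₀ hMa U hU hT α₁ hα₁ ha U' hU' n lam hc y y' hcut hs
  obtain ⟨⟨⟨⟨⟨k0, k1⟩, k2⟩, k3⟩, k4⟩, k5⟩ := H i hM α₀ hα₀ hMa U hU hT α₁ hα₁ ha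
  have hB : 0 ≤ max (max (max (max (max b0 b1) b2) b3) b4) b5 :=
    le_trans hb0.le (le_trans (le_max_left _ _) (le_trans (le_max_left _ _) (le_trans (le_max_left _ _)
      (le_trans (le_max_left _ _) (le_max_left _ _)))))
  have w := fun (m : Fin 6) (b e : ℝ) (hb : b ≤ max (max (max (max (max b0 b1) b2) b3) b4) b5)
      (he : min (min (min (min (min e0 e1) e2) e3) e4) e5 ≤ e)
      (k : (K i).l2 m ((bg i).mul U' U) lam hc ≤
        b * B9.pref6 ((geo i).len y) m * (geo i).cutSup hc * Real.exp (-(e * (geo i).dist y y')) *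
          (geo i).l2Norm lam) =>
    weaken5 k hb hB (pref6_nonneg ((S i).len_nonneg y) m) ((S i).cutSup_nonneg hc) ((S i).l2Norm_nonneg lam) he
      ((S i).dist_nonneg y y')
  fin_cases n
  · exact w 0 b0 e0 (le_trans (le_max_left _ _) (le_trans (le_max_left _ _) (le_trans (le_max_left _ _)
      (le_trans (le_max_left _ _) (le_max_left _ _))))) (le_trans (min_le_left _ _) (le_trans (min_le_left _ _)
      (le_trans (min_le_left _ _) (le_trans (min_le_left _ _) (min_le_left _ _))))) (k0 U' hU' lam hc y y' hcut hs)
  · exact w 1 b1 e1 (le_trans (le_max_right _ _) (le_trans (le_max_left _ _) (le_trans (le_max_left _ _)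
      (le_trans (le_max_left _ _) (le_max_left _ _))))) (le_trans (min_le_left _ _) (le_trans (min_le_left _ _)
      (le_trans (min_le_left _ _) (le_trans (min_le_left _ _) (min_le_right _ _))))) (k1 U' hU' lam hc y y' hcut hs)
  · exact w 2 b2 e2 (le_trans (le_max_right _ _) (le_trans (le_max_left _ _) (le_trans (le_max_left _ _)
      (le_max_left _ _)))) (le_trans (min_le_left _ _) (le_trans (min_le_left _ _) (le_trans (min_le_left _ _)
      (min_le_right _ _)))) (k2 U' hU' lam hc y y' hcut hs)
  · exact w 3 b3 e3 (le_trans (le_max_right _ _) (le_trans (le_max_left _ _) (le_max_left _ _)))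
      (le_trans (min_le_left _ _) (le_trans (min_le_left _ _) (min_le_right _ _))) (k3 U' hU' lam hc y y' hcut hs)
  · exact w 4 b4 e4 (le_trans (le_max_right _ _) (le_max_left _ _)) (le_trans (min_le_left _ _) (min_le_right _ _))
      (k4 U' hU' lam hc y y' hcut hs)
  · exact w 5 b5 e5 (le_max_right _ _) (min_le_right _ _) (k5 U' hU' lam hc y y' hcut hs)

/-- ★ **`B9.SectBStepPrinted` FROM THE POSITIVE-INPUT STEPS, GIVEN THEOREMS 3.2 AND 3.3** (p. 407: *"Thus Theorem 3.4 is
proved, assuming that Theorems 3.1–3.3 hold"*): the analytic-extension step, the whole (3.42)–(3.47) positive-input steps for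
G′ and G and the (3.48) positive-input step are APPLIED AT THE POSITIVE CONSTANTS OF THEOREMS 3.2 ∕ 3.3 (which hold at every
(3.35)-regular U above their thresholds), so the leaf's arbitrary input tuple is by-passed; M-threshold = max, α₀-threshold =
min, output constants merged between G′ and G under the model signs (§1).  Nothing of Sect. B asserted.
[cite: Balaban1985BackgroundPropagators, Thm 3.4 p.400 + Sect. B (3.62)–(3.67) pp.402–403 + (3.86) p.407 + Thms 3.2–3.3 pp.398–399] -/
theorem sectBStepPrinted_of_posSteps {P : ∀ i, (geo i).Loc → Prop} (S : ∀ i, ModelSignsOn (geo i) (P i))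
    {IsAnalyticExt : ∀ i, B9.KernelFamily (geo i) (bg i) → (bg i).Cfg → ℝ → Prop}
    (h32 : B9.Thm32Printed d c35 geo bg Cinv) (h33 : B9.Thm33Printed c35 geo bg Gp GA)
    (hA : StepAnalyticPos d c35 geo bg Gp GA Cinv IsAnalyticExt) (hP : StepAllPos d c35 geo bg Gp GA Cinv Gp)
    (hK : StepKerPos d c35 geo bg Gp GA Cinv Cinv) (hQ : StepAllPos d c35 geo bg Gp GA Cinv GA) :
    B9.SectBStepPrinted d c35 geo bg Gp GA Cinv IsAnalyticExt := by
  have h := ((hA.and hP).and hK).and hQ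
  intro _ _ _ _ _ _ _
  obtain ⟨M₂, δ₂, a₂, B₂, hM₂, hδ₂, ha₂, hB₂, H2⟩ := h32
  obtain ⟨M₃, δ₃, a₃, B₃, Bβ₃, Bε₃, Bεβ₃, hM₃, hδ₃, ha₃, hB₃, H3⟩ := h33
  obtain ⟨M₀, a₁, a₀', ⟨⟨⟨_, cP⟩, ⟨B₁', δ₁'⟩⟩, cQ⟩, hM₀, ha₁, ha₀', ⟨⟨⟨-, hP0, hPδ⟩, hB₁', hδ₁'⟩, hQ0, hQδ⟩, H⟩ :=
    h B₃ δ₃ Bβ₃ Bε₃ Bεβ₃ B₂ δ₂ hB₃ hδ₃ hB₂ hδ₂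
  refine ⟨max (max M₂ M₃) M₀, a₁, min (min a₂ a₃) a₀', max cP.B₀ cQ.B₀, min cP.δ₀ cQ.δ₀,
    fun β => max 0 (max (cP.Bβ β) (cQ.Bβ β)), fun ε => max 0 (max (cP.Bε ε) (cQ.Bε ε)),
    fun ε β => max 0 (max (cP.Bεβ ε β) (cQ.Bεβ ε β)), B₁', δ₁',
    lt_max_of_lt_right hM₀, ha₁, lt_min (lt_min ha₂ ha₃) ha₀', lt_max_of_lt_left hP0, lt_min hPδ hQδ, hB₁', hδ₁', ?_⟩
  intro i hM α₀ hα₀ hMa U hU _ α₁ hα₁ ha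
  have hM2 : M₂ ≤ (geo i).M := le_trans (le_trans (le_max_left _ _) (le_max_left _ _)) hM
  have hM3 : M₃ ≤ (geo i).M := le_trans (le_trans (le_max_right _ _) (le_max_left _ _)) hM
  have hM0 : M₀ ≤ (geo i).M := le_trans (le_max_right _ _) hM
  have ha2' : (geo i).M * α₀ ≤ a₂ := le_trans hMa (le_trans (min_le_left _ _) (min_le_left _ _))
  have ha3' : (geo i).M * α₀ ≤ a₃ := le_trans hMa (le_trans (min_le_left _ _) (min_le_right _ _))
  have ha0'' : (geo i).M * α₀ ≤ a₀' := le_trans hMa (min_le_right _ _)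
  have h3i := H3 i hM3 α₀ hα₀ ha3' U hU
  have hT : B9.Thms31to33IneqAt d (Gp i) (GA i) (Cinv i) B₃ δ₃ Bβ₃ Bε₃ Bεβ₃ B₂ δ₂ U :=
    ⟨h3i.1, H2 i hM2 α₀ hα₀ ha2' U hU, h3i.2⟩
  obtain ⟨⟨⟨hAi, hPi⟩, hKi⟩, hQi⟩ := H i hM0 α₀ hα₀ ha0'' U hU hT α₁ hα₁ ha
  refine ⟨hAi.1, hAi.2, fun U' hU' => ?_⟩
  obtain ⟨hP1, hP2⟩ := hPi U' hU'
  obtain ⟨hQ1, hQ2⟩ := hQi U' hU'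
  have hB0 : 0 ≤ max cP.B₀ cQ.B₀ := le_trans hP0.le (le_max_left _ _)
  refine ⟨⟨ineq342_346_347_mono (S i) hP1 (le_max_left _ _) hB0 (min_le_left _ _),
      ineq343_345_mono (S i) hP2 (fun β => le_trans (le_max_left _ _) (le_max_right _ _)) (fun β => le_max_left _ _)
        (fun ε => le_trans (le_max_left _ _) (le_max_right _ _)) (fun ε => le_max_left _ _)
        (fun ε β => le_trans (le_max_left _ _) (le_max_right _ _)) (fun ε β => le_max_left _ _) (min_le_left _ _)⟩,
    hKi U' hU',
    ⟨ineq342_346_347_mono (S i) hQ1 (le_max_right _ _) hB0 (min_le_right _ _),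
      ineq343_345_mono (S i) hQ2 (fun β => le_trans (le_max_right _ _) (le_max_right _ _)) (fun β => le_max_left _ _)
        (fun ε => le_trans (le_max_right _ _) (le_max_right _ _)) (fun ε => le_max_left _ _)
        (fun ε β => le_trans (le_max_right _ _) (le_max_right _ _)) (fun ε β => le_max_left _ _)
        (min_le_right _ _)⟩⟩

/-- ★ **`B9.SectBStepPrinted` FROM THE FOURTEEN POSITIVE-INPUT BLOCK-STEPS, GIVEN THEOREMS 3.2 AND 3.3** — the shape in
which a letters instance over the tree's Sect. B programme discharges `hB` block by block (`stepAllPos_of_blocks` twice +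
`sectBStepPrinted_of_posSteps`; the (3.46) block per member via `stepL2Pos_of_members`).
[cite: Balaban1985BackgroundPropagators, Thm 3.4 p.400 + Sect. B pp.402–407 + Thms 3.2–3.3 pp.398–399] -/
theorem sectBStepPrinted_of_posBlockSteps {P : ∀ i, (geo i).Loc → Prop} (S : ∀ i, ModelSignsOn (geo i) (P i))
    {IsAnalyticExt : ∀ i, B9.KernelFamily (geo i) (bg i) → (bg i).Cfg → ℝ → Prop}
    (h32 : B9.Thm32Printed d c35 geo bg Cinv) (h33 : B9.Thm33Printed c35 geo bg Gp GA)
    (hA : StepAnalyticPos d c35 geo bg Gp GA Cinv IsAnalyticExt)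
    (hEp : StepEPos d c35 geo bg Gp GA Cinv Gp) (hLp : StepL2Pos d c35 geo bg Gp GA Cinv Gp)
    (hGp : StepGlobPos d c35 geo bg Gp GA Cinv Gp) (hH1p : StepH1Pos d c35 geo bg Gp GA Cinv Gp)
    (hE4p : StepE4Pos d c35 geo bg Gp GA Cinv Gp) (hH2p : StepH2Pos d c35 geo bg Gp GA Cinv Gp)
    (hK : StepKerPos d c35 geo bg Gp GA Cinv Cinv)
    (hEa : StepEPos d c35 geo bg Gp GA Cinv GA) (hLa : StepL2Pos d c35 geo bg Gp GA Cinv GA)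
    (hGa : StepGlobPos d c35 geo bg Gp GA Cinv GA) (hH1a : StepH1Pos d c35 geo bg Gp GA Cinv GA)
    (hE4a : StepE4Pos d c35 geo bg Gp GA Cinv GA) (hH2a : StepH2Pos d c35 geo bg Gp GA Cinv GA) :
    B9.SectBStepPrinted d c35 geo bg Gp GA Cinv IsAnalyticExt :=
  sectBStepPrinted_of_posSteps S h32 h33 hA (stepAllPos_of_blocks S hEp hLp hGp hH1p hE4p hH2p) hK
    (stepAllPos_of_blocks S hEa hLa hGa hH1a hE4a hH2a)

end PosSteps

/-! ## §6 (v1.3) The analytic-extension step split per family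

`StepAnalyticPos` (§5) conjoins the two families G′ and G (Theorem 3.4: *"the operators G′(U), …, G(U) extend to configurations
U′U … as analytic functions of A"*).  A letters instance reaches the G′ half long before the G half (the G letters are heavier), so
the pinnable unit is the ONE-FAMILY step `StepAnalyticPos1 IsAnalyticExt K`; `stepAnalyticPos_of_halves` recombines. -/

section AnalyticSplit

variable {I : Type} (d : ℕ) (c35 : ℝ) (geo : I → B9.Geometry) (bg : I → B9.Backgrounds)
  (Gp GA : ∀ i, B9.KernelFamily (geo i) (bg i)) (Cinv : ∀ i, B9.SiteKernel (geo i) (bg i))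

/-- **Positive-input analytic-extension step for ONE kernel family** (Theorem 3.4 p. 400 for K = G′ or K = G separately; mechanism
(3.62)–(3.64) resp. (3.86)). [cite: Balaban1985BackgroundPropagators, Thm 3.4 p.400 + (3.62)–(3.64) p.402 + (3.86) p.407] -/
def StepAnalyticPos1 (IsAnalyticExt : ∀ i, B9.KernelFamily (geo i) (bg i) → (bg i).Cfg → ℝ → Prop)
    (K : ∀ i, B9.KernelFamily (geo i) (bg i)) : Prop :=
  StepPos d c35 geo bg Gp GA Cinv PUnit (fun _ => True) (fun _ i U α₁ => IsAnalyticExt i (K i) U α₁)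

variable {d c35 geo bg Gp GA Cinv}

/-- **The two one-family analytic steps ⇒ `StepAnalyticPos`** (thresholds merged by `StepPos.and`).
[cite: Balaban1985BackgroundPropagators, Thm 3.4 p.400] -/
theorem stepAnalyticPos_of_halves {IsAnalyticExt : ∀ i, B9.KernelFamily (geo i) (bg i) → (bg i).Cfg → ℝ → Prop}
    (hP : StepAnalyticPos1 d c35 geo bg Gp GA Cinv IsAnalyticExt Gp) (hQ : StepAnalyticPos1 d c35 geo bg Gp GA Cinv IsAnalyticExt GA) :
    StepAnalyticPos d c35 geo bg Gp GA Cinv IsAnalyticExt :=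
  StepPos.mono (fun _ => PUnit.unit) (fun _ _ => trivial) (fun _ _ _ _ _ h => h) (hP.and hQ)

end AnalyticSplit

end Literature.MathematicalPhysics.QuantumFieldTheory.Balaban1983to89.B9SectBStepWhole
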